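import Summits.Ventures.QEC.CircuitDistance.PortCoverFast
import Summits.Ventures.QEC.CircuitDistance.SchedSectorFinal
import HarnessLib

/-!
# Q4 lane, ₛ-spine (9C): FAST coverage soundness and the sector theorems with SEMANTIC coverage, for any CNOT order
# (`PortCoverFast.lean` re-pointed to `xDEMₛ/zDEMₛ σ` under `hσ : σ.CycleFacts S`; venture QEC, experiment cell CDX, seat
# qec-cdx-type-2; proofs verbatim; nothing here asserts a value of `d_circ`)

Reused unchanged (order-free): `pdiff`, `candSet`, `dropEq`, `subsetSorted`, `lexLe`, `colKey`, `leafNullKeys`, `XTable.nullKeys`/`ZTable.nullKeys`,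
the checkers `XTable.covers₁`/`ZTable.covers₁`. Re-pointed: **`xcovers₁_soundₛ`/`zcovers₁_soundₛ`**, **`no_xLogical_of_leavesCₛ`/
`no_zLogical_of_leavesCₛ (hσ)`** (the form `PortBB144Value` uses for print's order: `Fibre.Covers₀` per leaf + class-word completeness).
-/

namespace Summit.Ventures.QEC.CircuitDistance

open Literature.InformationTheory.QuantumCodes

variable {ℓ m : ℕ} [NeZero ℓ] [NeZero m]

/-- **Fast coverage soundness** (`X`), any order with the cycle facts (cf. `xcovers₁_sound`; the checker `XTable.covers₁` is order-free). -/
theorem xcovers₁_soundₛ {σ : SMSchedule} {S : SMCode ℓ m} (hσ : σ.CycleFacts S) (T : XTable ℓ m) (hS : T.ShapeCorrectₛ σ S)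
    (Nc : ℕ) (e : LeafEntry ℓ m) (h : T.covers₁ S Nc e = true) : Fibre.Covers₀ (xDEMₛ σ S T Nc) (scope Nc) encDet e.word e.leaf := by
  unfold XTable.covers₁ at h
  simp only [Bool.and_eq_true, decide_eq_true_eq, List.all_eq_true, List.mem_range, Bool.or_eq_true] at h
  obtain ⟨⟨hlen, hall⟩, hnull⟩ := h
  refine ⟨encDet_injective, hlen, fun f hf j hcls => ?_, ?_⟩
  · obtain ⟨h₁, h₂⟩ := hf
    change (f.xKind.bind fun ki => (T.cls ki.1).map (trQ ki.2)) = some e.word[j] at hcls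
    rcases hk : f.xKind with _ | ⟨k, i⟩
    · rw [hk] at hcls; simp at hcls
    · rw [hk, Option.bind_some] at hcls
      have hkall : k ∈ XKind.all := XKind.mem_all k (fun lay => Fault.xKind_ne_zero hk lay)
      have hjk := hall j j.2 k hkall
      rcases hc : T.cls k with _ | g₀
      · rw [hc] at hcls; simp at hcls
      · rw [hc] at hcls hjk
        simp only [Option.map_some, Option.some.injEq] at hcls
        simp only [decide_eq_true_eq] at hjk
        have hwd : e.word.getD (j : ℕ) ∅ = e.word[j] := List.getD_eq_getElem _ _ j.2
        rw [hwd] at hjk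
        obtain ⟨c, hc', hcc⟩ := hjk i (mem_candSet hcls) hcls (f.cyc - 1) (by omega)
        refine ⟨c, hc', ?_⟩
        rw [hcc, Nat.sub_add_cancel h₁, XTable.detFast_eq_xDetₛ hσ (hS k hkall) Nc i f.cyc h₁ h₂, ← xDetₛ_eq_of_xKind σ S Nc f hk]
        rfl
  · by_cases hb : e.leaf.budget = 0
    · exact Or.inl hb
    · refine Or.inr fun f hf hcls => ?_
      rcases hnull with hnull | hnull
      · exact absurd hnull hb
      obtain ⟨h₁, h₂⟩ := hf
      change (f.xKind.bind fun ki => (T.cls ki.1).map (trQ ki.2)) = none at hcls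
      rcases hk : f.xKind with _ | ⟨k, i⟩
      · exact Or.inl (xDetₛ_eq_empty_of_xKind σ S Nc f hk)
      · rw [hk, Option.bind_some] at hcls
        have hkall : k ∈ XKind.all := XKind.mem_all k (fun lay => Fault.xKind_ne_zero hk lay)
        have hcn : T.cls k = none := by
          rcases hc : T.cls k with _ | g₀
          · rfl
          · rw [hc] at hcls; simp at hcls
        have hcol : T.detFast S Nc k i (f.cyc - 1 + 1) = xDetₛ σ S Nc f := by
          rw [Nat.sub_add_cancel h₁, XTable.detFast_eq_xDetₛ hσ (hS k hkall) Nc i f.cyc h₁ h₂, ← xDetₛ_eq_of_xKind σ S Nc f hk]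
        by_cases he : xDetₛ σ S Nc f = ∅
        · exact Or.inl he
        · right
          have hkey : colKey ((xDetₛ σ S Nc f).image encDet) ∈ T.nullKeys S Nc := by
            unfold XTable.nullKeys
            rw [List.mem_flatMap]
            refine ⟨(k, i), List.pair_mem_product.2 ⟨hkall, mem_monoList i⟩, ?_⟩
            simp only [hcn]
            rw [List.mem_filterMap]
            refine ⟨f.cyc - 1, List.mem_range.2 (by omega), ?_⟩
            rw [hcol, if_neg he]
          have hsub := mem_of_subsetSorted _ _ hnull _ ((List.mem_mergeSort).2 hkey)
          rw [List.mem_mergeSort] at hsub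
          obtain ⟨c, hcn', hck⟩ := exists_null_of_mem_leafNullKeys e.leaf hsub
          exact ⟨c, hcn', by rw [colKey_inj hck]; rfl⟩

/-- **Fast coverage soundness** (`Z`), any order with the cycle facts (cf. `zcovers₁_sound`). -/
theorem zcovers₁_soundₛ {σ : SMSchedule} {S : SMCode ℓ m} (hσ : σ.CycleFacts S) (T : ZTable ℓ m) (hS : T.ShapeCorrectₛ σ S)
    (Nc : ℕ) (e : LeafEntry ℓ m) (h : T.covers₁ S Nc e = true) : Fibre.Covers₀ (zDEMₛ σ S T Nc) (scope Nc) encDet e.word e.leaf := by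
  unfold ZTable.covers₁ at h
  simp only [Bool.and_eq_true, decide_eq_true_eq, List.all_eq_true, List.mem_range, Bool.or_eq_true] at h
  obtain ⟨⟨hlen, hall⟩, hnull⟩ := h
  refine ⟨encDet_injective, hlen, fun f hf j hcls => ?_, ?_⟩
  · obtain ⟨h₁, h₂⟩ := hf
    change (f.zKind.bind fun ki => (T.cls ki.1).map (trQ ki.2)) = some e.word[j] at hcls
    rcases hk : f.zKind with _ | ⟨k, i⟩
    · rw [hk] at hcls; simp at hcls
    · rw [hk, Option.bind_some] at hcls
      have hkall : k ∈ ZKind.all := ZKind.mem_all k (fun lay => Fault.zKind_ne_zero hk lay)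
      have hjk := hall j j.2 k hkall
      rcases hc : T.cls k with _ | g₀
      · rw [hc] at hcls; simp at hcls
      · rw [hc] at hcls hjk
        simp only [Option.map_some, Option.some.injEq] at hcls
        simp only [decide_eq_true_eq] at hjk
        have hwd : e.word.getD (j : ℕ) ∅ = e.word[j] := List.getD_eq_getElem _ _ j.2
        rw [hwd] at hjk
        obtain ⟨c, hc', hcc⟩ := hjk i (mem_candSet hcls) hcls (f.cyc - 1) (by omega)
        refine ⟨c, hc', ?_⟩
        rw [hcc, Nat.sub_add_cancel h₁, ZTable.detFast_eq_zDetₛ hσ (hS k hkall) Nc i f.cyc h₁ h₂, ← zDetₛ_eq_of_zKind σ S Nc f hk]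
        rfl
  · by_cases hb : e.leaf.budget = 0
    · exact Or.inl hb
    · refine Or.inr fun f hf hcls => ?_
      rcases hnull with hnull | hnull
      · exact absurd hnull hb
      obtain ⟨h₁, h₂⟩ := hf
      change (f.zKind.bind fun ki => (T.cls ki.1).map (trQ ki.2)) = none at hcls
      rcases hk : f.zKind with _ | ⟨k, i⟩
      · exact Or.inl (zDetₛ_eq_empty_of_zKind σ S Nc f hk)
      · rw [hk, Option.bind_some] at hcls
        have hkall : k ∈ ZKind.all := ZKind.mem_all k (fun lay => Fault.zKind_ne_zero hk lay)
        have hcn : T.cls k = none := by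
          rcases hc : T.cls k with _ | g₀
          · rfl
          · rw [hc] at hcls; simp at hcls
        have hcol : T.detFast S k i (f.cyc - 1 + 1) = zDetₛ σ S Nc f := by
          rw [Nat.sub_add_cancel h₁, ZTable.detFast_eq_zDetₛ hσ (hS k hkall) Nc i f.cyc h₁ h₂, ← zDetₛ_eq_of_zKind σ S Nc f hk]
        by_cases he : zDetₛ σ S Nc f = ∅
        · exact Or.inl he
        · right
          have hkey : colKey ((zDetₛ σ S Nc f).image encDet) ∈ T.nullKeys S Nc := by
            unfold ZTable.nullKeys
            rw [List.mem_flatMap]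
            refine ⟨(k, i), List.pair_mem_product.2 ⟨hkall, mem_monoList i⟩, ?_⟩
            simp only [hcn]
            rw [List.mem_filterMap]
            refine ⟨f.cyc - 1, List.mem_range.2 (by omega), ?_⟩
            rw [hcol, if_neg he]
          have hsub := mem_of_subsetSorted _ _ hnull _ ((List.mem_mergeSort).2 hkey)
          rw [List.mem_mergeSort] at hsub
          obtain ⟨c, hcn', hck⟩ := exists_null_of_mem_leafNullKeys e.leaf hsub
          exact ⟨c, hcn', by rw [colKey_inj hck]; rfl⟩

/-! ## Sector theorems with semantic coverage -/

/-- **`X`-SECTOR THEOREM with SEMANTIC coverage, any CNOT order with the cycle facts** (cf. `no_xLogical_of_leavesC`; `Fibre.Covers₀`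
per leaf, fed from `xcovers₀_soundₛ` / `xcovers₁_soundₛ` / `xcovers₂_soundₛ`). -/
theorem no_xLogical_of_leavesCₛ {σ : SMSchedule} {S : SMCode ℓ m} (hσ : σ.CycleFacts S) (T : XTable ℓ m)
    (hS : T.ShapeCorrectₛ σ S) (hC : T.ClassCorrect S) (N₀ w : ℕ) (leaves : List (LeafEntry ℓ m))
    (hwf : ∀ e ∈ leaves, e.leaf.wf = true ∧ Fibre.Covers₀ (xDEMₛ σ S T N₀) (scope N₀) encDet e.word e.leaf ∧ e.word.Nodup ∧ e.leaf.w = w ∧ e.leaf.budget ≤ 1 ∧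
      ¬ e.leaf.Realised)
    (hcomplete : ∀ x : Finset (Finset (BB.Mono ℓ m ⊕ BB.Mono ℓ m)), (∀ g ∈ x, IsXClass T g) →
      XNontrivial S (∑ g ∈ x, indic g) → x.card ≤ w → ∃ e ∈ leaves, ∃ t : BB.Mono ℓ m, x = (e.word.map (trQ t)).toFinset) :
    ¬ ∃ F : Finset (Fault ℓ m), Gen.Undetectable S N₀ (allEventsₛ σ N₀) F ∧
        Gen.dataX S (allEventsₛ σ N₀) F ∉ rowSpace S.toCode.HX ∧ faultCount F ≤ w := by
  classical
  rintro ⟨F, hU, hL, hw⟩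
  obtain ⟨F₁, hR, hcard, himg, hX, hZ, hdX, hdZ⟩ := Gen.exists_reduced S N₀ (allEventsₛ σ N₀) F
  have hU₁ : Gen.Undetectable S N₀ (allEventsₛ σ N₀) F₁ := by
    refine ⟨fun f' hf' => ?_, fun t i => ⟨?_, ?_⟩⟩
    · have : f'.loc ∈ F.image Fault.loc := himg (Finset.mem_image_of_mem _ hf')
      obtain ⟨f, hf, hfl⟩ := Finset.mem_image.1 this
      rw [← Fault.ev_eq_of_loc_eq hfl]; exact hU.1 f hf
    · rw [hX]; exact (hU.2 t i).1
    · rw [hZ]; exact (hU.2 t i).2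
  have hNT : XNontrivial S (Gen.dataX S (allEventsₛ σ N₀) F₁) := ⟨(residual_syndrome_zeroₛ hσ N₀ F₁ hU₁).1, by rw [hdX]; exact hL⟩
  have hscope : ∀ f ∈ F₁, f ∈ scope (ℓ := ℓ) (m := m) N₀ := by
    intro f hf
    have := hU₁.1 f hf
    rw [hσ.mem_allEventsₛ_iff, Fault.ev_cyc] at this
    exact this
  have key := Fibre.no_silent_nontrivial (xDEMₛ σ S T N₀) (scope N₀) (classHyp_xDEMₛ hσ T hS hC N₀) (XNontrivial S)
    (fun v s hs => xNontrivial_add_stab S v s hs) w ?_ F₁ hscope (hcard.trans hw) (silent_xDEMₛ σ S T N₀ F₁ hU₁)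
  · apply key
    show XNontrivial S (∑ f ∈ F₁, Gen.dataX S (allEventsₛ σ N₀) {f})
    rw [← Gen.dataX_eq_sum]; exact hNT
  intro x hx hxw
  by_cases hcl : ∀ g ∈ x, IsXClass T g
  · obtain ⟨e, he, t, rfl⟩ := hcomplete x hcl hx hxw
    obtain ⟨hwfe, hcov, hnd, hwe, hb, hnr⟩ := hwf e he
    have hcovers := hcov
    have hlen : e.word.length = e.leaf.k := hcovers.2.1
    rw [word_map_toFinset, Finset.card_map, List.toFinset_card_of_nodup hnd, hlen]
    show ¬ Fibre.TightRealisable (xDEMₛ σ S T N₀) (scope N₀) (e.word.toFinset.map (xSymmₛ σ S T N₀ t).onGen.toEmbedding) _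
    rw [Fibre.tightRealisable_map_iff (xDEMₛ σ S T N₀) (scope N₀) (xSymmₛ σ S T N₀ t)]
    have hbud : w - e.leaf.k = e.leaf.budget := by unfold Fibre.Leaf.budget; rw [hwe]
    rw [hbud]
    exact Fibre.not_tightRealisable_of_notRealised₀ (xDEMₛ σ S T N₀) (scope N₀) encDet e.word hnd e.leaf hcovers hnr hb
  · -- a non-class word is never realised
    push Not at hcl
    obtain ⟨g, hgx, hg⟩ := hcl
    rintro ⟨G, -, -, hproj, -⟩
    have hgp : g ∈ Fibre.proj (xDEMₛ σ S T N₀) G := by rw [hproj]; exact hgx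
    obtain ⟨f, -, hf⟩ := isClass_of_mem_proj (xDEMₛ σ S T N₀) G g hgp
    exact hg (isXClass_of_clsₛ σ S T N₀ f g hf)

/-- **`Z`-SECTOR THEOREM with SEMANTIC coverage, any CNOT order with the cycle facts** (cf. `no_zLogical_of_leavesC`). -/
theorem no_zLogical_of_leavesCₛ {σ : SMSchedule} {S : SMCode ℓ m} (hσ : σ.CycleFacts S) (T : ZTable ℓ m)
    (hS : T.ShapeCorrectₛ σ S) (hC : T.ClassCorrect S) (N₀ w : ℕ) (leaves : List (LeafEntry ℓ m))
    (hwf : ∀ e ∈ leaves, e.leaf.wf = true ∧ Fibre.Covers₀ (zDEMₛ σ S T N₀) (scope N₀) encDet e.word e.leaf ∧ e.word.Nodup ∧ e.leaf.w = w ∧ e.leaf.budget ≤ 1 ∧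
      ¬ e.leaf.Realised)
    (hcomplete : ∀ x : Finset (Finset (BB.Mono ℓ m ⊕ BB.Mono ℓ m)), (∀ g ∈ x, IsZClass T g) →
      ZNontrivial S (∑ g ∈ x, indic g) → x.card ≤ w → ∃ e ∈ leaves, ∃ t : BB.Mono ℓ m, x = (e.word.map (trQ t)).toFinset) :
    ¬ ∃ F : Finset (Fault ℓ m), Gen.Undetectable S N₀ (allEventsₛ σ N₀) F ∧
        Gen.dataZ S (allEventsₛ σ N₀) F ∉ rowSpace S.toCode.HZ ∧ faultCount F ≤ w := by
  classical
  rintro ⟨F, hU, hL, hw⟩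
  obtain ⟨F₁, hR, hcard, himg, hX, hZ, hdX, hdZ⟩ := Gen.exists_reduced S N₀ (allEventsₛ σ N₀) F
  have hU₁ : Gen.Undetectable S N₀ (allEventsₛ σ N₀) F₁ := by
    refine ⟨fun f' hf' => ?_, fun t i => ⟨?_, ?_⟩⟩
    · have : f'.loc ∈ F.image Fault.loc := himg (Finset.mem_image_of_mem _ hf')
      obtain ⟨f, hf, hfl⟩ := Finset.mem_image.1 this
      rw [← Fault.ev_eq_of_loc_eq hfl]; exact hU.1 f hf
    · rw [hX]; exact (hU.2 t i).1
    · rw [hZ]; exact (hU.2 t i).2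
  have hNT : ZNontrivial S (Gen.dataZ S (allEventsₛ σ N₀) F₁) := ⟨(residual_syndrome_zeroₛ hσ N₀ F₁ hU₁).2, by rw [hdZ]; exact hL⟩
  have hscope : ∀ f ∈ F₁, f ∈ scope (ℓ := ℓ) (m := m) N₀ := by
    intro f hf
    have := hU₁.1 f hf
    rw [hσ.mem_allEventsₛ_iff, Fault.ev_cyc] at this
    exact this
  have key := Fibre.no_silent_nontrivial (zDEMₛ σ S T N₀) (scope N₀) (classHyp_zDEMₛ hσ T hS hC N₀) (ZNontrivial S)
    (fun v s hs => zNontrivial_add_stab S v s hs) w ?_ F₁ hscope (hcard.trans hw) (silent_zDEMₛ σ S T N₀ F₁ hU₁)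
  · apply key
    show ZNontrivial S (∑ f ∈ F₁, Gen.dataZ S (allEventsₛ σ N₀) {f})
    rw [← Gen.dataZ_eq_sum]; exact hNT
  intro x hx hxw
  by_cases hcl : ∀ g ∈ x, IsZClass T g
  · obtain ⟨e, he, t, rfl⟩ := hcomplete x hcl hx hxw
    obtain ⟨hwfe, hcov, hnd, hwe, hb, hnr⟩ := hwf e he
    have hcovers := hcov
    have hlen : e.word.length = e.leaf.k := hcovers.2.1
    rw [word_map_toFinset, Finset.card_map, List.toFinset_card_of_nodup hnd, hlen]
    show ¬ Fibre.TightRealisable (zDEMₛ σ S T N₀) (scope N₀) (e.word.toFinset.map (zSymmₛ σ S T N₀ t).onGen.toEmbedding) _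
    rw [Fibre.tightRealisable_map_iff (zDEMₛ σ S T N₀) (scope N₀) (zSymmₛ σ S T N₀ t)]
    have hbud : w - e.leaf.k = e.leaf.budget := by unfold Fibre.Leaf.budget; rw [hwe]
    rw [hbud]
    exact Fibre.not_tightRealisable_of_notRealised₀ (zDEMₛ σ S T N₀) (scope N₀) encDet e.word hnd e.leaf hcovers hnr hb
  · push Not at hcl
    obtain ⟨g, hgx, hg⟩ := hcl
    rintro ⟨G, -, -, hproj, -⟩
    have hgp : g ∈ Fibre.proj (zDEMₛ σ S T N₀) G := by rw [hproj]; exact hgx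
    obtain ⟨f, -, hf⟩ := isClass_of_mem_proj (zDEMₛ σ S T N₀) G g hgp
    exact hg (isZClass_of_clsₛ σ S T N₀ f g hf)


end Summit.Ventures.QEC.CircuitDistance
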